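import Literature.ModelTheory.ExponentialFields.CharbonnelClosure
import HarnessLib

/-!
# The Charbonnel closure over `ℝ` is a weak structure: cylinders, permutations, products, intersections

Topic `Literature/ModelTheory/ExponentialFields`.  Second half of Fornasiero–Servi's Theorem 7.4
(*Fund. Math.* 209 (2010): "*if `𝒮` is a semi-closed o-minimal weak structure, then its Charbonnel
closure `𝒮̃` is a semi-closed o-minimal weak structure*"; a weak structure is "*closed under
finite intersection, cartesian product and permutation of the variables*", Def. 7.2) for the
Charbonnel closure `IsCh` of the `L_exp`-term zero sets over `ℝ` (`CharbonnelClosure.lean`), by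
the rank inductions of Berarducci–Servi (*Ann. Pure Appl. Logic* 125 (2004), Remark 4.6 and
Lemmas 4.7–4.9: permutations commute with the Charbonnel operations; `𝒮̃` is closed under `×` by
induction on `ρ(X) + ρ(Y)` using `cl(A) × Z = cl(A × Z)` for closed `Z`; hence under `∩`):

* `IsCh.preimage_precomp` — pull-backs `{y | y ∘ σ ∈ A}` along injective coordinate maps
  (cylinders `IsCh.cylRight`, `IsCh.cylLeft`, permutations `IsCh.perm`);
* `IsCh.prod` — products `A × B ⊆ ℝᵃ⁺ᵇ`; `IsCh.inter` — intersections; `IsCh.projLast` —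
  projections forgetting the last `e` coordinates; `IsCh.univ`, `IsCh.empty`, `IsCh.affine`;
* `IsCh.image_affine`, `IsCh.preimage_affine` — images and preimages under affine maps given by
  matrices (via graphs, which are affine subspaces).

Everything is proved; no new definitions besides abbreviations in proofs; no named facts.

## References

* [FornasieroServi2010] A. Fornasiero, T. Servi, Fund. Math. 209 (2010), Def. 7.2, Def. 7.3,
  Thm. 7.4 (arXiv:0803.3560, held).
* [BerarducciServi2004] A. Berarducci, T. Servi, Ann. Pure Appl. Logic 125 (2004), Def. 4.1,
  Def. 4.4, Remark 4.6, Lemmas 4.7–4.9 (held text, §4).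
* [Charbonnel1991] J.-Y. Charbonnel, Ann. Inst. Fourier 41 (1991), Lemme 2.2 (i)–(iv).
-/

noncomputable section

open Set Function FirstOrder FirstOrder.Language

namespace Literature.ModelTheory.ExponentialFields

namespace IsCh

variable {n : ℕ}

/-! ### Basic members -/

/-- `ℝⁿ ∈ 𝒮̃` (zero locus of `0`). [cite: FornasieroServi2010, Def. 7.2] -/
theorem univ (n : ℕ) : IsCh (Set.univ : Set (Fin n → ℝ)) := by
  have h := IsCh.zero (0 : Language.orderedExpRing.Term (Fin 0 ⊕ Fin n)) Fin.elim0
  have : zeroLocus (0 : Language.orderedExpRing.Term (Fin 0 ⊕ Fin n)) Fin.elim0 = Set.univ := by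
    ext x; simp [zeroLocus, Language.orderedExpRing.realize_zero]
  rwa [this] at h

/-- `∅ ∈ 𝒮̃` (zero locus of `1`). [cite: FornasieroServi2010, Def. 7.2] -/
theorem empty (n : ℕ) : IsCh (∅ : Set (Fin n → ℝ)) := by
  have h := IsCh.zero (1 : Language.orderedExpRing.Term (Fin 0 ⊕ Fin n)) Fin.elim0
  have : zeroLocus (1 : Language.orderedExpRing.Term (Fin 0 ⊕ Fin n)) Fin.elim0 = ∅ := by
    ext x; simp [zeroLocus, Language.orderedExpRing.realize_one]
  rwa [this] at h

/-- Affine subspaces are in `𝒮̃`. [cite: FornasieroServi2010, Def. 7.2] -/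
theorem affine (L : AffineSubspace ℝ (Fin n → ℝ)) : IsCh (L : Set (Fin n → ℝ)) := by
  simpa using IsCh.interAffine L (IsCh.univ n)

/-! ### Pull-backs along injective coordinate maps -/

/-- The linear map `y ↦ y ∘ σ` as an affine map. [folklore] -/
def precompAffineMap {n n' : ℕ} (σ : Fin n → Fin n') : (Fin n' → ℝ) →ᵃ[ℝ] (Fin n → ℝ) :=
  (LinearMap.funLeft ℝ ℝ σ).toAffineMap

/-- `precompAffineMap σ y = y ∘ σ`. [folklore] -/
@[simp] theorem precompAffineMap_apply {n n' : ℕ} (σ : Fin n → Fin n') (y : Fin n' → ℝ) :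
    precompAffineMap σ y = y ∘ σ := rfl

/-- **`𝒮̃` is closed under pull-backs along injective coordinate maps** (cylinders and
permutations of the variables; Berarducci–Servi, Remark 4.6: "*linear bijections induced by a
permutation of the variables commute with union, intersection, projection and closure*").
[cite: BerarducciServi2004, Remark 4.6] [cite: FornasieroServi2010, Thm. 7.4] -/
theorem preimage_precomp {A : Set (Fin n → ℝ)} (hA : IsCh A) :
    ∀ {n' : ℕ} {σ : Fin n → Fin n'}, Injective σ → IsCh {y : Fin n' → ℝ | y ∘ σ ∈ A} := by
  induction hA with
  | @zero m n t β =>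
    intro n' σ _
    have : {y : Fin n' → ℝ | y ∘ σ ∈ zeroLocus t β} = zeroLocus (t.relabel (Sum.map id σ)) β := by
      ext y
      simp [zeroLocus, Term.realize_relabel, Sum.elim_comp_map]
    rw [this]
    exact IsCh.zero _ β
  | union _ _ ihA ihB =>
    intro n' σ hσ
    exact (ihA hσ).union (ihB hσ)
  | @interAffine n A L _ ih =>
    intro n' σ hσ
    have : {y : Fin n' → ℝ | y ∘ σ ∈ A ∩ (L : Set (Fin n → ℝ))} =
        {y : Fin n' → ℝ | y ∘ σ ∈ A} ∩ (L.comap (precompAffineMap σ) : Set (Fin n' → ℝ)) := by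
      ext y
      simp [AffineSubspace.coe_comap]
    rw [this]
    exact (ih hσ).interAffine _
  | @proj n A₀ _ ih =>
    intro n' σ hσ
    -- lift `σ` to `σ' = σ ⊕ id : Fin (n + 1) → Fin (n' + 1)`
    have hσ' : Injective (finSumMap σ (id : Fin 1 → Fin 1)) := finSumMap_injective hσ injective_id
    have key : {y : Fin n' → ℝ | y ∘ σ ∈ Fin.init '' A₀} =
        Fin.init '' {z : Fin (n' + 1) → ℝ | z ∘ finSumMap σ (id : Fin 1 → Fin 1) ∈ A₀} := by
      ext y
      simp only [mem_setOf_eq, mem_image]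
      constructor
      · rintro ⟨z₀, hz₀, hyz⟩
        refine ⟨Fin.snoc y (z₀ (Fin.last n)), ?_, ?_⟩
        · have : (Fin.snoc y (z₀ (Fin.last n)) : Fin (n' + 1) → ℝ) ∘ finSumMap σ id = z₀ := by
            ext i
            induction i using Fin.lastCases with
            | last =>
              have h1 : finSumMap σ (id : Fin 1 → Fin 1) (Fin.last n) = Fin.last n' := by
                have : Fin.last n = Fin.natAdd n (0 : Fin 1) := by ext; simp
                rw [this, finSumMap_natAdd]; ext; simp
              simp [h1]
            | cast i =>
              have h1 : finSumMap σ (id : Fin 1 → Fin 1) (Fin.castSucc i) = Fin.castSucc (σ i) := by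
                have : Fin.castSucc i = Fin.castAdd 1 i := rfl
                rw [this, finSumMap_castAdd]; rfl
              have h2 := congr_fun hyz i
              simp only [Fin.init, Function.comp_apply] at h2
              simp [h1, h2.symm]
          rw [this]; exact hz₀
        · simp
      · rintro ⟨z, hz, rfl⟩
        refine ⟨z ∘ finSumMap σ id, hz, ?_⟩
        ext i
        have h1 : finSumMap σ (id : Fin 1 → Fin 1) (Fin.castSucc i) = Fin.castSucc (σ i) := by
          have : Fin.castSucc i = Fin.castAdd 1 i := rfl
          rw [this, finSumMap_castAdd]; rfl
        simp [Fin.init, h1]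
    rw [key]
    exact (ih hσ').proj
  | @closure n A _ ih =>
    intro n' σ hσ
    rw [preimage_closure_precompCoord hσ]
    exact (ih hσ).closure

/-- Right cylinders `A × ℝᵉ`. [cite: FornasieroServi2010, Thm. 7.4] -/
theorem cylRight {A : Set (Fin n → ℝ)} (hA : IsCh A) (e : ℕ) :
    IsCh {y : Fin (n + e) → ℝ | y ∘ Fin.castAdd e ∈ A} :=
  hA.preimage_precomp (Fin.castAdd_injective _ _)

/-- Left cylinders `ℝᵉ × A`. [cite: FornasieroServi2010, Thm. 7.4] -/
theorem cylLeft {A : Set (Fin n → ℝ)} (hA : IsCh A) (e : ℕ) :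
    IsCh {y : Fin (e + n) → ℝ | y ∘ Fin.natAdd e ∈ A} :=
  hA.preimage_precomp (Fin.natAdd_injective _ _)

/-- Permutations (and renumberings) of the variables. [cite: BerarducciServi2004, Remark 4.6] -/
theorem perm {n' : ℕ} {A : Set (Fin n → ℝ)} (hA : IsCh A) (σ : Fin n ≃ Fin n') :
    IsCh {y : Fin n' → ℝ | y ∘ σ ∈ A} :=
  hA.preimage_precomp σ.injective

/-! ### Products -/

/-- The product `A × B ⊆ ℝᵃ⁺ᵇ` of `A ⊆ ℝᵃ`, `B ⊆ ℝᵇ`, as a set of tuples. [folklore] -/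
def sprod {a b : ℕ} (A : Set (Fin a → ℝ)) (B : Set (Fin b → ℝ)) : Set (Fin (a + b) → ℝ) :=
  {z | z ∘ Fin.castAdd b ∈ A ∧ z ∘ Fin.natAdd a ∈ B}

/-- The product as an intersection of two cylinders. [folklore] -/
theorem sprod_eq_inter {a b : ℕ} (A : Set (Fin a → ℝ)) (B : Set (Fin b → ℝ)) :
    sprod A B = {z | z ∘ Fin.castAdd b ∈ A} ∩ {z | z ∘ Fin.natAdd a ∈ B} := rfl

/-- `(A₁ ∪ A₂) × B`. [folklore] -/
theorem union_sprod {a b : ℕ} (A₁ A₂ : Set (Fin a → ℝ)) (B : Set (Fin b → ℝ)) :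
    sprod (A₁ ∪ A₂) B = sprod A₁ B ∪ sprod A₂ B := by
  ext z; simp only [sprod, mem_setOf_eq, mem_union]; tauto

/-- `A × (B₁ ∪ B₂)`. [folklore] -/
theorem sprod_union {a b : ℕ} (A : Set (Fin a → ℝ)) (B₁ B₂ : Set (Fin b → ℝ)) :
    sprod A (B₁ ∪ B₂) = sprod A B₁ ∪ sprod A B₂ := by
  ext z; simp only [sprod, mem_setOf_eq, mem_union]; tauto

/-- `(A₁ ∩ A₂) × B`. [folklore] -/
theorem inter_sprod {a b : ℕ} (A₁ A₂ : Set (Fin a → ℝ)) (B : Set (Fin b → ℝ)) :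
    sprod (A₁ ∩ A₂) B = sprod A₁ B ∩ {z | z ∘ Fin.castAdd b ∈ A₂} := by
  ext z; simp only [sprod, mem_setOf_eq, mem_inter_iff]; tauto

/-- `A × (B₁ ∩ B₂)`. [folklore] -/
theorem sprod_inter {a b : ℕ} (A : Set (Fin a → ℝ)) (B₁ B₂ : Set (Fin b → ℝ)) :
    sprod A (B₁ ∩ B₂) = sprod A B₁ ∩ {z | z ∘ Fin.natAdd a ∈ B₂} := by
  ext z; simp only [sprod, mem_setOf_eq, mem_inter_iff]; tauto

/-- `cl A × cl B = cl(A × B)`. [folklore] -/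
theorem closure_sprod {a b : ℕ} (A : Set (Fin a → ℝ)) (B : Set (Fin b → ℝ)) :
    _root_.closure (sprod A B) = sprod (_root_.closure A) (_root_.closure B) :=
  closure_setOf_blocks A B

/-- The pull-back of an affine subspace along a coordinate block, as a set. [folklore] -/
theorem setOf_comp_mem_affine {a a' : ℕ} (σ : Fin a → Fin a') (L : AffineSubspace ℝ (Fin a → ℝ)) :
    {z : Fin a' → ℝ | z ∘ σ ∈ (L : Set (Fin a → ℝ))} =
      (L.comap (precompAffineMap σ) : Set (Fin a' → ℝ)) := by
  ext z; simp [AffineSubspace.coe_comap]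

/-- `A × π(B₁) = π(A × B₁)` (last coordinate). [folklore] -/
theorem sprod_image_init {a b : ℕ} (A : Set (Fin a → ℝ)) (B₁ : Set (Fin (b + 1) → ℝ)) :
    sprod A (Fin.init '' B₁) =
      (Fin.init (n := a + b) : (Fin (a + b + 1) → ℝ) → (Fin (a + b) → ℝ)) ''
        sprod (a := a) (b := b + 1) A B₁ := by
  ext z
  simp only [sprod, mem_setOf_eq, mem_image]
  constructor
  · rintro ⟨hzA, w, hw, hwz⟩
    refine ⟨Fin.snoc z (w (Fin.last b)), ⟨?_, ?_⟩, by simp⟩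
    · have : (Fin.snoc z (w (Fin.last b)) : Fin (a + b + 1) → ℝ) ∘ Fin.castAdd (b + 1) =
          z ∘ Fin.castAdd b := by
        ext i
        have h1 : (Fin.castAdd (b + 1) i : Fin (a + b + 1)) = Fin.castSucc (Fin.castAdd b i) := by
          ext; simp
        rw [Function.comp_apply, h1, Fin.snoc_castSucc]; rfl
      rw [this]; exact hzA
    · have : (Fin.snoc z (w (Fin.last b)) : Fin (a + b + 1) → ℝ) ∘ Fin.natAdd a = w := by
        ext j
        induction j using Fin.lastCases with
        | last =>
          have h1 : (Fin.natAdd a (Fin.last b) : Fin (a + b + 1)) = Fin.last (a + b) := by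
            ext; simp
          rw [Function.comp_apply, h1, Fin.snoc_last]
        | cast j =>
          have h1 : (Fin.natAdd a (Fin.castSucc j) : Fin (a + b + 1)) =
              Fin.castSucc (Fin.natAdd a j) := by ext; simp
          have h2 := congr_fun hwz j
          simp only [Fin.init] at h2
          rw [Function.comp_apply, h1, Fin.snoc_castSucc]
          exact h2.symm
      rw [this]; exact hw
  · rintro ⟨w, ⟨hwA, hwB⟩, rfl⟩
    refine ⟨?_, w ∘ Fin.natAdd a, hwB, ?_⟩
    · have : Fin.init w ∘ Fin.castAdd b = w ∘ Fin.castAdd (b + 1) := by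
        ext i
        simp only [Fin.init, Function.comp_apply]
        congr 1
      rw [this]; exact hwA
    · ext j
      simp only [Fin.init, Function.comp_apply]
      congr 1

/-- `π(A₀) × B` is, up to a renumbering of the variables, `π` of `A₀ × B` with the projected
coordinate moved last. [folklore] -/
theorem sprod_init_image {a b : ℕ} (A₀ : Set (Fin (a + 1) → ℝ)) (B : Set (Fin b → ℝ)) :
    ∃ σ : Fin (a + 1 + b) ≃ Fin (a + b + 1),
      sprod (Fin.init '' A₀) B =
        Fin.init '' {w : Fin (a + b + 1) → ℝ | w ∘ σ ∈ sprod A₀ B} := by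
  -- `σ` sends `(x, t, y) ↦ (x, y, t)`-indices: block structure `(Fin a ⊕ Fin 1) ⊕ Fin b ≃ (Fin a ⊕ Fin b) ⊕ Fin 1`
  let e₁ : Fin (a + 1 + b) ≃ (Fin a ⊕ Fin 1) ⊕ Fin b :=
    finSumFinEquiv.symm.trans (Equiv.sumCongr finSumFinEquiv.symm (Equiv.refl _))
  let e₂ : (Fin a ⊕ Fin 1) ⊕ Fin b ≃ (Fin a ⊕ Fin b) ⊕ Fin 1 :=
    (Equiv.sumAssoc _ _ _).trans ((Equiv.sumCongr (Equiv.refl _) (Equiv.sumComm _ _)).trans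
      (Equiv.sumAssoc _ _ _).symm)
  let e₃ : (Fin a ⊕ Fin b) ⊕ Fin 1 ≃ Fin (a + b + 1) :=
    (Equiv.sumCongr finSumFinEquiv (Equiv.refl _)).trans finSumFinEquiv
  let σ : Fin (a + 1 + b) ≃ Fin (a + b + 1) := e₁.trans (e₂.trans e₃)
  have hσx : ∀ i : Fin a, σ (Fin.castAdd b (Fin.castSucc i)) = Fin.castSucc (Fin.castAdd b i) := by
    intro i
    have : Fin.castSucc i = Fin.castAdd 1 i := rfl
    apply Fin.ext
    simp [σ, e₁, e₂, e₃, this, finSumFinEquiv_symm_apply_castAdd, finSumFinEquiv_apply_left]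
  have hσt : σ (Fin.castAdd b (Fin.last a)) = Fin.last (a + b) := by
    have : Fin.last a = Fin.natAdd a (0 : Fin 1) := by ext; simp
    apply Fin.ext
    simp [σ, e₁, e₂, e₃, this, finSumFinEquiv_symm_apply_castAdd, finSumFinEquiv_symm_apply_natAdd,
      finSumFinEquiv_apply_right]
  have hσy : ∀ j : Fin b, σ (Fin.natAdd (a + 1) j) = Fin.castSucc (Fin.natAdd a j) := by
    intro j
    apply Fin.ext
    simp [σ, e₁, e₂, e₃, finSumFinEquiv_symm_apply_natAdd, finSumFinEquiv_apply_left,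
      finSumFinEquiv_apply_right]
  refine ⟨σ, ?_⟩
  ext z
  simp only [sprod, mem_setOf_eq, mem_image]
  constructor
  · rintro ⟨⟨x₀, hx₀, hx₀z⟩, hzB⟩
    -- `w = (z, t)` with `t` the last coordinate of `x₀`
    refine ⟨Fin.snoc z (x₀ (Fin.last a)), ⟨?_, ?_⟩, by simp⟩
    · have : ((Fin.snoc z (x₀ (Fin.last a)) : Fin (a + b + 1) → ℝ) ∘ σ) ∘ Fin.castAdd b = x₀ := by
        ext i
        induction i using Fin.lastCases with
        | last => simp only [Function.comp_apply, hσt, Fin.snoc_last]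
        | cast i =>
          have h2 := congr_fun hx₀z i
          simp only [Fin.init] at h2
          simp only [Function.comp_apply, hσx, Fin.snoc_castSucc]
          exact h2.symm
      rw [this]; exact hx₀
    · have : ((Fin.snoc z (x₀ (Fin.last a)) : Fin (a + b + 1) → ℝ) ∘ σ) ∘ Fin.natAdd (a + 1) =
          z ∘ Fin.natAdd a := by
        ext j
        simp only [Function.comp_apply, hσy, Fin.snoc_castSucc]
      rw [this]; exact hzB
  · rintro ⟨w, ⟨hwA, hwB⟩, rfl⟩
    refine ⟨⟨(w ∘ σ) ∘ Fin.castAdd b, hwA, ?_⟩, ?_⟩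
    · ext i
      simp only [Fin.init, Function.comp_apply, hσx]
    · have : Fin.init w ∘ Fin.natAdd a = (w ∘ σ) ∘ Fin.natAdd (a + 1) := by
        ext j
        simp only [Fin.init, Function.comp_apply, hσy]
      rw [this]; exact hwB

/-- Products with a term zero set on the left. [cite: BerarducciServi2004, Lemma 4.7] -/
theorem zeroLocus_sprod {m a b : ℕ} (t : Language.orderedExpRing.Term (Fin m ⊕ Fin a)) (β : Fin m → ℝ)
    {B : Set (Fin b → ℝ)} (hB : IsCh B) : IsCh (sprod (zeroLocus t β) B) := by
  induction hB with
  | @zero m' b s γ =>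
    -- `Z(t) × Z(s) = Z(t'² + s'²)` with parameters `(β, γ)`
    let t' : Language.orderedExpRing.Term (Fin (m + m') ⊕ Fin (a + b)) :=
      t.relabel (Sum.map (Fin.castAdd m') (Fin.castAdd b))
    let s' : Language.orderedExpRing.Term (Fin (m + m') ⊕ Fin (a + b)) :=
      s.relabel (Sum.map (Fin.natAdd m) (Fin.natAdd a))
    have : sprod (zeroLocus t β) (zeroLocus s γ) = zeroLocus (t' * t' + s' * s') (Fin.append β γ) := by
      ext z
      simp only [sprod, zeroLocus, mem_setOf_eq, Language.orderedExpRing.realize_add,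
        Language.orderedExpRing.realize_mul, t', s', Term.realize_relabel, Sum.elim_comp_map]
      have h1 : Fin.append β γ ∘ Fin.castAdd m' = β := by ext; simp
      have h2 : Fin.append β γ ∘ Fin.natAdd m = γ := by ext; simp
      rw [h1, h2]
      constructor
      · rintro ⟨ht, hs⟩; rw [ht, hs]; ring
      · intro h
        have ht : t.realize (Sum.elim β (z ∘ Fin.castAdd b)) * t.realize (Sum.elim β (z ∘ Fin.castAdd b)) = 0 := by
          nlinarith [mul_self_nonneg (t.realize (Sum.elim β (z ∘ Fin.castAdd b))),
            mul_self_nonneg (s.realize (Sum.elim γ (z ∘ Fin.natAdd a)))]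
        have hs : s.realize (Sum.elim γ (z ∘ Fin.natAdd a)) * s.realize (Sum.elim γ (z ∘ Fin.natAdd a)) = 0 := by
          nlinarith [mul_self_nonneg (t.realize (Sum.elim β (z ∘ Fin.castAdd b))),
            mul_self_nonneg (s.realize (Sum.elim γ (z ∘ Fin.natAdd a)))]
        exact ⟨mul_self_eq_zero.1 ht, mul_self_eq_zero.1 hs⟩
    rw [this]
    exact IsCh.zero _ _
  | union _ _ ih₁ ih₂ => rw [sprod_union]; exact ih₁.union ih₂
  | @interAffine b B L _ ih =>
    rw [sprod_inter, setOf_comp_mem_affine]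
    exact ih.interAffine _
  | @proj b B₁ _ ih => rw [sprod_image_init]; exact ih.proj
  | @closure b B₁ _ ih =>
    have hc : IsClosed (zeroLocus t β) := NF.isClosed_toSet (NF.ofTm t) β
    have hcl : sprod (zeroLocus t β) (_root_.closure B₁) = _root_.closure (sprod (zeroLocus t β) B₁) := by
      rw [closure_sprod, hc.closure_eq]
    rw [hcl]
    exact ih.closure

/-- **`𝒮̃` is closed under products** (Berarducci–Servi, Lemma 4.7/4.8, by induction on the
descriptions of both factors, the closure case using `cl A × Z = cl(A × Z)` for closed `Z` and
`cl A × cl B = cl(A × B)`). [cite: BerarducciServi2004, Lemma 4.7] [cite: FornasieroServi2010, Thm. 7.4] -/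
theorem prod {a : ℕ} {A : Set (Fin a → ℝ)} (hA : IsCh A) :
    ∀ {b : ℕ} {B : Set (Fin b → ℝ)}, IsCh B → IsCh (sprod A B) := by
  induction hA with
  | zero t β => intro b B hB; exact zeroLocus_sprod t β hB
  | union _ _ ih₁ ih₂ => intro b B hB; rw [union_sprod]; exact (ih₁ hB).union (ih₂ hB)
  | @interAffine a A L _ ih =>
    intro b B hB
    rw [inter_sprod, setOf_comp_mem_affine]
    exact (ih hB).interAffine _
  | @proj a A₀ _ ih =>
    intro b B hB
    obtain ⟨σ, hσ⟩ := sprod_init_image A₀ B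
    rw [hσ]
    exact ((ih hB).perm σ).proj
  | @closure a A₀ _ ihA =>
    intro b B hB
    induction hB with
    | zero s γ =>
      have hc : IsClosed (zeroLocus s γ) := NF.isClosed_toSet (NF.ofTm s) γ
      have hcl : sprod (_root_.closure A₀) (zeroLocus s γ) = _root_.closure (sprod A₀ (zeroLocus s γ)) := by
        rw [closure_sprod, hc.closure_eq]
      rw [hcl]; exact (ihA (IsCh.zero s γ)).closure
    | union h₁ h₂ ih₁ ih₂ => rw [sprod_union]; exact ih₁.union ih₂
    | @interAffine b B L _ ih =>
      rw [sprod_inter, setOf_comp_mem_affine]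
      exact ih.interAffine _
    | @proj b B₁ _ ih => rw [sprod_image_init]; exact ih.proj
    | @closure b B₁ hB₁ _ =>
      rw [← closure_sprod]
      exact (ihA hB₁).closure

/-! ### Intersections and projections -/

/-- Projection forgetting the last `e` coordinates. [cite: FornasieroServi2010, Def. 7.3] -/
theorem projLast {e : ℕ} : ∀ {A : Set (Fin (n + e) → ℝ)}, IsCh A →
    IsCh ((fun w : Fin (n + e) → ℝ => w ∘ Fin.castAdd e) '' A) := by
  induction e with
  | zero =>
    intro A hA
    have : (fun w : Fin (n + 0) → ℝ => w ∘ Fin.castAdd 0) '' A = A := by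
      have h : (fun w : Fin (n + 0) → ℝ => w ∘ Fin.castAdd 0) = id := by
        ext w i; rfl
      rw [h, Set.image_id]
    rw [this]; exact hA
  | succ e ih =>
    intro A hA
    have : (fun w : Fin (n + (e + 1)) → ℝ => w ∘ Fin.castAdd (e + 1)) '' A =
        (fun w : Fin (n + e) → ℝ => w ∘ Fin.castAdd e) '' (Fin.init '' A) := by
      rw [Set.image_image]
      apply Set.image_congr
      intro w _
      ext i
      simp only [Function.comp_apply, Fin.init]
      congr 1
    rw [this]
    exact ih hA.proj

/-- The diagonal `{(x, x)} ⊆ ℝⁿ⁺ⁿ` is an affine subspace. [folklore] -/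
def diagonalSubspace (n : ℕ) : AffineSubspace ℝ (Fin (n + n) → ℝ) :=
  (LinearMap.ker (LinearMap.funLeft ℝ ℝ (Fin.castAdd n) - LinearMap.funLeft ℝ ℝ (Fin.natAdd n))).toAffineSubspace

/-- Membership in the diagonal. [folklore] -/
theorem mem_diagonalSubspace (z : Fin (n + n) → ℝ) :
    z ∈ diagonalSubspace n ↔ z ∘ Fin.castAdd n = z ∘ Fin.natAdd n := by
  simp only [diagonalSubspace, Submodule.mem_toAffineSubspace, LinearMap.mem_ker, LinearMap.sub_apply,
    sub_eq_zero]
  exact Iff.rfl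

/-- **`𝒮̃` is closed under intersection**: `A ∩ B = π((A × B) ∩ Δ)`.
[cite: BerarducciServi2004, Lemma 4.9] [cite: FornasieroServi2010, Thm. 7.4] -/
theorem inter {A B : Set (Fin n → ℝ)} (hA : IsCh A) (hB : IsCh B) : IsCh (A ∩ B) := by
  have h := ((hA.prod hB).interAffine (diagonalSubspace n)).projLast (e := n)
  have hset : (fun w : Fin (n + n) → ℝ => w ∘ Fin.castAdd n) ''
      (sprod A B ∩ (diagonalSubspace n : Set (Fin (n + n) → ℝ))) = A ∩ B := by
    ext x
    simp only [mem_image, mem_inter_iff, SetLike.mem_coe, mem_diagonalSubspace, sprod, mem_setOf_eq]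
    constructor
    · rintro ⟨w, ⟨⟨hwA, hwB⟩, hdiag⟩, rfl⟩
      exact ⟨hwA, hdiag ▸ hwB⟩
    · rintro ⟨hxA, hxB⟩
      refine ⟨Fin.append x x, ⟨⟨?_, ?_⟩, ?_⟩, ?_⟩
      · rw [append_comp_castAdd]; exact hxA
      · rw [append_comp_natAdd]; exact hxB
      · rw [append_comp_castAdd, append_comp_natAdd]
      · exact append_comp_castAdd x x
  rw [hset] at h
  exact h

/-- Finite intersections. [cite: FornasieroServi2010, Def. 7.2] -/
theorem iInter_finset {ι : Type*} (s : Finset ι) {A : ι → Set (Fin n → ℝ)}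
    (hA : ∀ i ∈ s, IsCh (A i)) : IsCh (⋂ i ∈ s, A i) := by
  classical
  induction s using Finset.induction_on with
  | empty => simpa using IsCh.univ n
  | insert i s hi ih =>
    rw [Finset.set_biInter_insert]
    exact (hA i (Finset.mem_insert_self i s)).inter (ih fun j hj => hA j (Finset.mem_insert_of_mem hj))

/-- Finite unions. [cite: FornasieroServi2010, Def. 7.3] -/
theorem iUnion_finset {ι : Type*} (s : Finset ι) {A : ι → Set (Fin n → ℝ)}
    (hA : ∀ i ∈ s, IsCh (A i)) : IsCh (⋃ i ∈ s, A i) := by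
  classical
  induction s using Finset.induction_on with
  | empty => simpa using IsCh.empty n
  | insert i s hi ih =>
    rw [Finset.set_biUnion_insert]
    exact (hA i (Finset.mem_insert_self i s)).union (ih fun j hj => hA j (Finset.mem_insert_of_mem hj))

/-! ### Affine images and preimages -/

/-- The affine subspace `{w | Φ w = c}` of a linear map `Φ` (a fibre, e.g. a graph). [folklore] -/
def fibreSubspace {N k : ℕ} (Φ : (Fin N → ℝ) →ₗ[ℝ] (Fin k → ℝ)) (c : Fin k → ℝ) :
    AffineSubspace ℝ (Fin N → ℝ) :=
  (affineSpan ℝ {c}).comap Φ.toAffineMap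

/-- Membership in `fibreSubspace`. [folklore] -/
theorem mem_fibreSubspace {N k : ℕ} (Φ : (Fin N → ℝ) →ₗ[ℝ] (Fin k → ℝ)) (c : Fin k → ℝ)
    (w : Fin N → ℝ) : w ∈ fibreSubspace Φ c ↔ Φ w = c := by
  simp [fibreSubspace, AffineSubspace.mem_comap, AffineSubspace.mem_affineSpan_singleton]

/-- **Preimages under affine maps**: `{y | M y + c ∈ A} ∈ 𝒮̃` for `A ∈ 𝒮̃ₙ`.
[cite: FornasieroServi2010, Thm. 7.4] -/
theorem preimage_affine {m : ℕ} {A : Set (Fin n → ℝ)} (hA : IsCh A)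
    (M : (Fin m → ℝ) →ₗ[ℝ] (Fin n → ℝ)) (c : Fin n → ℝ) :
    IsCh {y : Fin m → ℝ | M y + c ∈ A} := by
  -- coordinates `(y, x) ∈ ℝᵐ⁺ⁿ` with `x ∈ A` and `x = M y + c`; project away `x`
  let Φ : (Fin (m + n) → ℝ) →ₗ[ℝ] (Fin n → ℝ) :=
    LinearMap.funLeft ℝ ℝ (Fin.natAdd m) - M.comp (LinearMap.funLeft ℝ ℝ (Fin.castAdd n))
  have hΦ : ∀ w : Fin (m + n) → ℝ, w ∈ fibreSubspace Φ c ↔ w ∘ Fin.natAdd m = M (w ∘ Fin.castAdd n) + c := by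
    intro w
    rw [mem_fibreSubspace]
    simp only [Φ, LinearMap.sub_apply, LinearMap.comp_apply]
    constructor
    · intro h; rw [← h]
      change w ∘ Fin.natAdd m = M (w ∘ Fin.castAdd n) + (w ∘ Fin.natAdd m - M (w ∘ Fin.castAdd n))
      abel
    · intro h
      show w ∘ Fin.natAdd m - M (w ∘ Fin.castAdd n) = c
      rw [h]; abel
  have h := (((hA.cylLeft m).interAffine (fibreSubspace Φ c)).projLast (e := n))
  have hset : (fun w : Fin (m + n) → ℝ => w ∘ Fin.castAdd n) ''
      ({y : Fin (m + n) → ℝ | y ∘ Fin.natAdd m ∈ A} ∩ (fibreSubspace Φ c : Set (Fin (m + n) → ℝ))) =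
      {y : Fin m → ℝ | M y + c ∈ A} := by
    ext y
    simp only [mem_image, mem_inter_iff, mem_setOf_eq, SetLike.mem_coe, hΦ]
    constructor
    · rintro ⟨w, ⟨hwA, hw⟩, rfl⟩
      rw [← hw]; exact hwA
    · intro hy
      refine ⟨Fin.append y (M y + c), ⟨?_, ?_⟩, append_comp_castAdd _ _⟩
      · rw [append_comp_natAdd]; exact hy
      · rw [append_comp_natAdd, append_comp_castAdd]
  rw [hset] at h
  exact h

/-- **Images under affine maps**: `{M x + c | x ∈ A} ∈ 𝒮̃` for `A ∈ 𝒮̃ₙ`.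
[cite: FornasieroServi2010, Thm. 7.4] -/
theorem image_affine {m : ℕ} {A : Set (Fin n → ℝ)} (hA : IsCh A)
    (M : (Fin n → ℝ) →ₗ[ℝ] (Fin m → ℝ)) (c : Fin m → ℝ) :
    IsCh ((fun x => M x + c) '' A) := by
  -- coordinates `(y, x) ∈ ℝᵐ⁺ⁿ` with `x ∈ A` and `y = M x + c`; project away `x`
  let Φ : (Fin (m + n) → ℝ) →ₗ[ℝ] (Fin m → ℝ) :=
    LinearMap.funLeft ℝ ℝ (Fin.castAdd n) - M.comp (LinearMap.funLeft ℝ ℝ (Fin.natAdd m))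
  have hΦ : ∀ w : Fin (m + n) → ℝ, w ∈ fibreSubspace Φ c ↔ w ∘ Fin.castAdd n = M (w ∘ Fin.natAdd m) + c := by
    intro w
    rw [mem_fibreSubspace]
    simp only [Φ, LinearMap.sub_apply, LinearMap.comp_apply]
    constructor
    · intro h; rw [← h]
      change w ∘ Fin.castAdd n = M (w ∘ Fin.natAdd m) + (w ∘ Fin.castAdd n - M (w ∘ Fin.natAdd m))
      abel
    · intro h
      show w ∘ Fin.castAdd n - M (w ∘ Fin.natAdd m) = c
      rw [h]; abel
  have h := (((hA.cylLeft m).interAffine (fibreSubspace Φ c)).projLast (e := n))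
  have hset : (fun w : Fin (m + n) → ℝ => w ∘ Fin.castAdd n) ''
      ({y : Fin (m + n) → ℝ | y ∘ Fin.natAdd m ∈ A} ∩ (fibreSubspace Φ c : Set (Fin (m + n) → ℝ))) =
      (fun x => M x + c) '' A := by
    ext y
    simp only [mem_image, mem_inter_iff, mem_setOf_eq, SetLike.mem_coe, hΦ]
    constructor
    · rintro ⟨w, ⟨hwA, hw⟩, rfl⟩
      exact ⟨w ∘ Fin.natAdd m, hwA, hw.symm⟩
    · rintro ⟨x, hx, rfl⟩
      refine ⟨Fin.append (M x + c) x, ⟨?_, ?_⟩, append_comp_castAdd _ _⟩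
      · rw [append_comp_natAdd]; exact hx
      · rw [append_comp_natAdd, append_comp_castAdd]
  rw [hset] at h
  exact h

end IsCh

end Literature.ModelTheory.ExponentialFields
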